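import Summits.BirchSwinnertonDyer.BirchSwinnertonDyer.Theorems.KolyvaginRoadThreeZhangInductionOnPosOddStart
import Summits.BirchSwinnertonDyer.BirchSwinnertonDyer.Theorems.KolyvaginRoadThreeMethod2Defs
import Summits.BirchSwinnertonDyer.BirchSwinnertonDyer.Theorems.KolyvaginRoadThreeMethod2CruxOfOddRank
import Summits.BirchSwinnertonDyer.BirchSwinnertonDyer.Theses.KolyvaginRoadThree
import Literature.NumberTheory.EllipticCurves.ZhangLevelRaisedHeegnerData
import Literature.NumberTheory.EllipticCurves.SelmerUnramified
import Literature.NumberTheory.GaloisRepresentations.IntegralGaloisAction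
import HarnessLib

/-!
# Route `KolyvaginRoadThree`, deciding crux `ZhangSharpFrameAtThreeHL` (item stmt-BirchSwinnertonDyer-19574):
# the crux BY NAME from the FIVE stubs of the reshaped METHOD skeleton v2z — A (rank lowering), P (parity),
# S1 (bottom base case), T (triangulation for abstract Kolyvagin systems) and Z (the level-raised Kolyvagin TOWER
# over the R-c objects `ZhangLevelRaisedHeegnerData`) — i.e. the kernel certificate of the S2 CUT
# (cell `bsd-stepL`, OWNER seat `bsd-stepL-koly` g14; `--supports stmt-BirchSwinnertonDyer-19574`, helper)

HONEST FRAMING. A CONDITIONAL composition: the five hypotheses are the five open-or-landed stub TEXTS of the skeleton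
`Lines-method2z-19574.lean` VERBATIM (A = `Method2StubA.stub_levelRaisingAtThree` is LANDED, koly g13 p489918; P is
landed modulo four published facts, koly3a p465420; S1, T, Z are open); no definition, no named fact, no `sorry`;
nothing is booked and the crux is NOT claimed. PARTITION: O2@3 (B10) × A1 (1 116 TRUE-OPEN) × crux 19574 — none
(composition; closes nothing; T7).

WHAT THE CUT IS (W. Zhang, Camb. J. Math. 2 (2014), §9 proof of Thm. 9.1, at `p = 3`, `3 ∥ N`). v2y's residual stub S2
(«Zhang's induction above the bottom, GIVEN (A1)») is replaced by
* T = Lemma 8.4 (1)+(3) for an ABSTRACT mod-3 Kolyvagin system relative to a GOOD even non-empty level `n` (axioms: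
  membership in the canonical level-`n` structure off the support with the sign law `ε·(−1)^{#m}`; TRANSVERSALITY on
  the support — the class dies on the decomposition group of `λ ∣ ℓ` inside `Gal(K̄/K[ℓ])`, `H¹_tr = ker(res K[ℓ]_λ)`,
  Mazur–Rubin 2004 Def. 1.1.6; (8.1) in vanishing form) — E-side Galois cohomology, provable by instantiating
  koly3b's `ZhangTriangulation.triangulation` (p481938);
* Z = THERE EXIST classes `κ(m, n)` REALISED at the bottom by the frame's own Kolyvagin classes and above the bottom
  by `Z_n.levelRaisedClass` of SOME level-raised Heegner data `Z_n` (Thm 2.1 + §3 at 3), satisfying T's axioms (Zhang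
  §8.1), the cohomological congruence Thm 4.3 pointwise in vanishing form, and the rank-one base case Thm 7.2 at every
  good even non-empty level — the deep residual (∃-form forced: the R-c structure does not record the CM provenance
  of `y_n(·)`, so ∀-forms of (A2)/(A5) over it are false);
and the p-uniform induction itself is PROVED here: engine `ZhangInductionOnPosOddStart` (koly g14 p495914: (A3) only
at NON-EMPTY levels, (A2)/(A5) only at EVEN levels, parity only at the start) fed with A = (A1), Z's pointwise (A2)
read contrapositively (a non-base point `q₂` of the upper system has a class with non-zero localisation above `q₂`,
hence above the inert `q₁ = (q₁)` one level down), T on Z's axioms = (A3), `relaxation_le` = (A4), S1-vacuous-at-`∅`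
+ Z's (A5⁺) = (A5), P in `SelQ ∅` currency (`finrank_selmer_eq_finrank_selQ_add`); the non-zero bottom class is E's
class of a Kolyvagin–Heegner datum of conductor `∏m` (`kolSupp_prod`). The `dim = 1` frames are S1's (witness `n = 1`).

References: [cite: WZhang2014, §9 proof of Thm. 9.1, Thm. 9.2, Lemma 8.4, Thm. 4.3, Thm. 7.2, Thm. 2.1, §8.1]
[cite: MazurRubin2004, Def. 1.1.6] [cite: GrossLMS1991, §3–§4, Prop. 6.2] [cite: BertoliniDarmon2005, Thm. 9.2].
-/

noncomputable section

open scoped Classical Pointwise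

namespace Summit.BirchSwinnertonDyer.Rank1Residual.X11b.Three.Koly.Method2TowerCut

open WeierstrassCurve NumberField IsDedekindDomain CategoryTheory
  Literature.NumberTheory.EllipticCurves Literature.NumberTheory.EllipticCurves.ModularForms
  Literature.NumberTheory.GaloisRepresentations Module

open Summit.BirchSwinnertonDyer.Rank1Residual.X11b.Three.Koly.Method2

/-- A square-free product of DISTINCT Kolyvagin primes (a finite set of them) has Kolyvagin-prime support.
[cite: GrossLMS1991, §3 (n square-free, every ℓ ∣ n a Kolyvagin prime)] -/
theorem kolSupp_prod {Kol : ℕ → Prop} (m : Finset {ℓ : ℕ // Kol ℓ}) (hprime : ∀ ℓ ∈ m, (ℓ : ℕ).Prime) :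
    KolyvaginDescent.KolSupp Kol (∏ ℓ ∈ m, (ℓ : ℕ)) := by
  induction m using Finset.induction_on with
  | empty => simpa using KolyvaginDescent.kolSupp_one Kol
  | insert a s ha ih =>
    have hs := ih (fun ℓ hℓ ↦ hprime ℓ (Finset.mem_insert_of_mem hℓ))
    have hpa := hprime a (Finset.mem_insert_self a s)
    have hne : (∏ ℓ ∈ s, (ℓ : ℕ)) ≠ 0 :=
      Finset.prod_ne_zero_iff.mpr fun ℓ hℓ ↦ (hprime ℓ (Finset.mem_insert_of_mem hℓ)).ne_zero
    rw [Finset.prod_insert ha]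
    refine ⟨?_, fun q hq ↦ ?_⟩
    · rw [Nat.squarefree_mul_iff]
      refine ⟨Nat.Coprime.prod_right fun ℓ hℓ ↦ ?_, hpa.squarefree, hs.1⟩
      refine (Nat.coprime_primes hpa (hprime ℓ (Finset.mem_insert_of_mem hℓ))).mpr fun h ↦ ha ?_
      rwa [Subtype.ext h]
    · rw [Nat.primeFactors_mul hpa.ne_zero hne, Finset.mem_union, hpa.primeFactors, Finset.mem_singleton] at hq
      rcases hq with rfl | hq
      · exact a.2
      · exact hs.2 q hq

/-- **`ZhangSharpFrameAtThreeHL` BY NAME from the five stub texts of skeleton v2z** — A (rank lowering at one good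
unipotent-admissible prime, LANDED p489918), P (3-parity of `Sel₃(E/K)`), S1 (Selmer rank one ⟹ `c(1) ≢ 0`), T (Lemma
8.4 for abstract mod-3 Kolyvagin systems at good even non-empty levels) and Z (the level-raised Kolyvagin tower over
`ZhangLevelRaisedHeegnerData` with (KS), Thm 4.3 pointwise, Thm 7.2 above the bottom) — by the parity case split and
W. Zhang's induction (engine `ZhangInductionOnPosOddStart`). CONDITIONAL; nothing is booked.
[cite: WZhang2014, §9 proof of Thm. 9.1 and Thm. 9.2] -/
theorem zhangSharpFrameAtThreeHL_of_tower_of_triangulation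
    (stub_levelRaisingAtThree :
      ∀ (W : WeierstrassCurve ℚ) [W.IsElliptic] [W.IsGloballyMinimal] [NeZero (W.conductorNorm ℤ)] (K : Type)
        [Field K] [NumberField K] (Dt : ModularParametrizationData W (W.conductorNorm ℤ)) (β : ℤ) (ι : K →+* ℂ),
        Summit.BirchSwinnertonDyer.Rank1Residual.ClassX11b W 3 → W.HasMultiplicativeReductionAtPrime 3 →
        Rank1Residual.Surj W 3 → Rank1Residual.Ram W 3 → ¬ 3 ∣ W.tamagawaProduct → IsImaginaryQuadratic K →
        Odd (NumberField.discr K) → SatisfiesHeegnerHypothesis (W.conductorNorm ℤ) K →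
        (W.quadraticTwist (NumberField.discr K : ℚ)).entireLFunction 1 ≠ 0 → NumberField.discr K ≠ -3 →
        (4 * (W.conductorNorm ℤ : ℤ)) ∣ β ^ 2 - NumberField.discr K → ¬ (3 : ℤ) ∣ Dt.c →
        ∀ (c : K ≃ₐ[ℚ] K), c ≠ 1 → ∀ [Module (ZMod 3) (V3 W K)],
        -- (A1) rank lowering at one new GOOD (non-scalar) unipotent-admissible prime, on good levels, (9.1)–(9.2)
        (∀ (n : Finset {q // IsUAdmissiblePrime W K q}) (μ : Bool) (x : V3 W K),
          GoodLevel W K n → x ∈ SelQ W K c n μ → x ≠ 0 →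
          ∃ q : {q // IsUAdmissiblePrime W K q}, q ∉ n ∧ GoodLevel W K (insert q n) ∧
            x ∉ SelQ W K c (insert q n) μ ∧
            SelQ W K c (insert q n) μ ≤ SelQ W K c n μ ∧
            finrank (ZMod 3) (SelQ W K c (insert q n) μ) + 1 = finrank (ZMod 3) (SelQ W K c n μ) ∧
            SelQ W K c (insert q n) (!μ) = SelQ W K c n (!μ)))
    (stub_oddSelmerRankAtThree :
      ∀ (W : WeierstrassCurve ℚ) [W.IsElliptic] [W.IsGloballyMinimal] [NeZero (W.conductorNorm ℤ)] (K : Type)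
        [Field K] [NumberField K] (Dt : ModularParametrizationData W (W.conductorNorm ℤ)) (β : ℤ) (ι : K →+* ℂ),
        Summit.BirchSwinnertonDyer.Rank1Residual.ClassX11b W 3 → W.HasMultiplicativeReductionAtPrime 3 →
        Rank1Residual.Surj W 3 → Rank1Residual.Ram W 3 → ¬ 3 ∣ W.tamagawaProduct → IsImaginaryQuadratic K →
        Odd (NumberField.discr K) → SatisfiesHeegnerHypothesis (W.conductorNorm ℤ) K →
        (W.quadraticTwist (NumberField.discr K : ℚ)).entireLFunction 1 ≠ 0 → NumberField.discr K ≠ -3 →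
        (4 * (W.conductorNorm ℤ : ℤ)) ∣ β ^ 2 - NumberField.discr K → ¬ (3 : ℤ) ∣ Dt.c →
        ∀ [Module (ZMod 3) (V3 W K)],
        Odd (finrank (ZMod 3)
          (AddSubgroup.toZModSubmodule 3 (selmerGroup (W.baseChange K) ((3 ^ 1 : ℕ) : ℤ)))))
    (stub_bottomRankOneAtThree :
      ∀ (W : WeierstrassCurve ℚ) [W.IsElliptic] [W.IsGloballyMinimal] [NeZero (W.conductorNorm ℤ)] (K : Type)
        [Field K] [NumberField K] (Dt : ModularParametrizationData W (W.conductorNorm ℤ)) (β : ℤ) (ι : K →+* ℂ),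
        Summit.BirchSwinnertonDyer.Rank1Residual.ClassX11b W 3 → W.HasMultiplicativeReductionAtPrime 3 →
        Rank1Residual.Surj W 3 → Rank1Residual.Ram W 3 → ¬ 3 ∣ W.tamagawaProduct → IsImaginaryQuadratic K →
        Odd (NumberField.discr K) → SatisfiesHeegnerHypothesis (W.conductorNorm ℤ) K →
        (W.quadraticTwist (NumberField.discr K : ℚ)).entireLFunction 1 ≠ 0 → NumberField.discr K ≠ -3 →
        (4 * (W.conductorNorm ℤ : ℤ)) ∣ β ^ 2 - NumberField.discr K → ¬ (3 : ℤ) ∣ Dt.c →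
        ∀ [Module (ZMod 3) (V3 W K)],
        finrank (ZMod 3)
          (AddSubgroup.toZModSubmodule 3 (selmerGroup (W.baseChange K) ((3 ^ 1 : ℕ) : ℤ))) = 1 →
        ∃ d : KolyvaginHeegnerData Dt β ι 1, d.kolyvaginClass Nat.prime_three 1 ≠ 0)
    (stub_triangulationAtThree :
      ∀ (W : WeierstrassCurve ℚ) [W.IsElliptic] [W.IsGloballyMinimal] [NeZero (W.conductorNorm ℤ)] (K : Type)
        [Field K] [NumberField K] (Dt : ModularParametrizationData W (W.conductorNorm ℤ)) (β : ℤ) (ι : K →+* ℂ),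
        Summit.BirchSwinnertonDyer.Rank1Residual.ClassX11b W 3 → W.HasMultiplicativeReductionAtPrime 3 →
        Rank1Residual.Surj W 3 → Rank1Residual.Ram W 3 → ¬ 3 ∣ W.tamagawaProduct → IsImaginaryQuadratic K →
        Odd (NumberField.discr K) → SatisfiesHeegnerHypothesis (W.conductorNorm ℤ) K →
        (W.quadraticTwist (NumberField.discr K : ℚ)).entireLFunction 1 ≠ 0 → NumberField.discr K ≠ -3 →
        (4 * (W.conductorNorm ℤ : ℤ)) ∣ β ^ 2 - NumberField.discr K → ¬ (3 : ℤ) ∣ Dt.c →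
        ∀ (c : K ≃ₐ[ℚ] K), c ≠ 1 → ∀ [Module (ZMod 3) (V3 W K)],
        ∀ (n : Finset {q // IsUAdmissiblePrime W K q}), GoodLevel W K n → n.Nonempty → Even n.card →
        ∀ (κ : Finset {ℓ // Zhang2014.IsKolyvaginPrime (W.conductorNorm ℤ) W K 3 ℓ} →
            Finset {q // IsUAdmissiblePrime W K q} → V3 W K) (ε : Bool),
        -- (KS1) property (1) off the support, sign law ε·(−1)^(#m): membership in the canonical level-n structure
        --       relaxed at (Kummer condition dropped above) the support of m
        (∀ m : Finset {ℓ // Zhang2014.IsKolyvaginPrime (W.conductorNorm ℤ) W K 3 ℓ},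
          κ m n ∈ levelSelmerSubgroup W K c (n.image Subtype.val) ↑(m.image Subtype.val) (ε ^^ Nat.bodd m.card)) →
        -- (KS2) property (1) on the support: TRANSVERSE at the place λ ∣ ℓ ∈ m (zero on the decomposition group of every
        --       prime 𝔓 ∣ λ of K̄ inside Gal(K̄/K[ℓ]))
        (∀ (m : Finset {ℓ // Zhang2014.IsKolyvaginPrime (W.conductorNorm ℤ) W K 3 ℓ}) (ℓ : {ℓ // Zhang2014.IsKolyvaginPrime (W.conductorNorm ℤ) W K 3 ℓ}), ℓ ∈ m →
          ∀ (v : HeightOneSpectrum (𝓞 K)), ((ℓ : ℕ) : 𝓞 K) ∈ v.asIdeal → ∀ 𝔓 ∈ v.primesAbove,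
          κ m n ∈ subgroupResKer (geomTorsion (W.baseChange K) ((3 ^ 1 : ℕ) : ℤ))
            (𝔓.decompositionSubgroup (Field.absoluteGaloisGroup K) ⊓ ringClassStabilizer K ι (ℓ : ℕ) (ℓ : ℕ))) →
        -- (KS3) (8.1) in vanishing form at the place λ ∣ ℓ, ℓ ∉ m
        (∀ (m : Finset {ℓ // Zhang2014.IsKolyvaginPrime (W.conductorNorm ℤ) W K 3 ℓ}) (ℓ : {ℓ // Zhang2014.IsKolyvaginPrime (W.conductorNorm ℤ) W K 3 ℓ}), ℓ ∉ m →
          ∀ (v : HeightOneSpectrum (𝓞 K)), ((ℓ : ℕ) : 𝓞 K) ∈ v.asIdeal →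
          (κ (insert ℓ m) n ∈ (W.baseChange K).torsionLocalKer (v.adicCompletion K) ((3 ^ 1 : ℕ) : ℤ) ↔
            κ m n ∈ (W.baseChange K).torsionLocalKer (v.adicCompletion K) ((3 ^ 1 : ℕ) : ℤ))) →
        (∃ m, κ m n ≠ 0) →
        ∃ (s : Bool) (d : ℕ), finrank (ZMod 3) (SelQ W K c n s) = d + 1 ∧
          SelQ W K c n s = SelRelQ W K c n (baseLocusQ W K κ n) s ∧
          FiniteDimensional (ZMod 3) (SelRelQ W K c n (baseLocusQ W K κ n) (!s)) ∧
          finrank (ZMod 3) (SelRelQ W K c n (baseLocusQ W K κ n) (!s)) ≤ d)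
    (stub_zhangTowerAtThree :
      ∀ (W : WeierstrassCurve ℚ) [W.IsElliptic] [W.IsGloballyMinimal] [NeZero (W.conductorNorm ℤ)] (K : Type)
        [Field K] [NumberField K] (Dt : ModularParametrizationData W (W.conductorNorm ℤ)) (β : ℤ) (ι : K →+* ℂ),
        Summit.BirchSwinnertonDyer.Rank1Residual.ClassX11b W 3 → W.HasMultiplicativeReductionAtPrime 3 →
        Rank1Residual.Surj W 3 → Rank1Residual.Ram W 3 → ¬ 3 ∣ W.tamagawaProduct → IsImaginaryQuadratic K →
        Odd (NumberField.discr K) → SatisfiesHeegnerHypothesis (W.conductorNorm ℤ) K →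
        (W.quadraticTwist (NumberField.discr K : ℚ)).entireLFunction 1 ≠ 0 → NumberField.discr K ≠ -3 →
        (4 * (W.conductorNorm ℤ : ℤ)) ∣ β ^ 2 - NumberField.discr K → ¬ (3 : ℤ) ∣ Dt.c →
        ∀ (c : K ≃ₐ[ℚ] K), c ≠ 1 → ∀ [Module (ZMod 3) (V3 W K)],
        ∃ (κ : Finset {ℓ // Zhang2014.IsKolyvaginPrime (W.conductorNorm ℤ) W K 3 ℓ} →
            Finset {q // IsUAdmissiblePrime W K q} → V3 W K)
          (ε : Finset {q // IsUAdmissiblePrime W K q} → Bool),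
          -- (R∅) realisation at the bottom by E's own Kolyvagin classes
          (∀ m : Finset {ℓ // Zhang2014.IsKolyvaginPrime (W.conductorNorm ℤ) W K 3 ℓ}, ∃ d : KolyvaginHeegnerData Dt β ι (∏ ℓ ∈ m, (ℓ : ℕ)),
            κ m ∅ = d.kolyvaginClass Nat.prime_three 1) ∧
          -- (R⁺) realisation above the bottom by LEVEL-RAISED Heegner data (R-c objects)
          (∀ n : Finset {q // IsUAdmissiblePrime W K q}, GoodLevel W K n → n.Nonempty → Even n.card →
            ∃ (_ : NeZero (∏ q ∈ n, (q : ℕ)))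
              (Z : ZhangLevelRaisedHeegnerData W K ι (W.conductorNorm ℤ) (∏ q ∈ n, (q : ℕ)) 3)
              (kc : ∀ m : Finset {ℓ // Zhang2014.IsKolyvaginPrime (W.conductorNorm ℤ) W K 3 ℓ}, RingClassKolyvaginChoice K ι (∏ ℓ ∈ m, (ℓ : ℕ))),
              ∀ m : Finset {ℓ // Zhang2014.IsKolyvaginPrime (W.conductorNorm ℤ) W K 3 ℓ}, κ m n = Z.levelRaisedClass Nat.prime_three (∏ ℓ ∈ m, (ℓ : ℕ)) (kc m)) ∧
          -- (KS) the Kolyvagin-system axioms of stub T at every good even non-empty level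
          (∀ n : Finset {q // IsUAdmissiblePrime W K q}, GoodLevel W K n → n.Nonempty → Even n.card →
            (∀ m : Finset {ℓ // Zhang2014.IsKolyvaginPrime (W.conductorNorm ℤ) W K 3 ℓ}, κ m n ∈
              levelSelmerSubgroup W K c (n.image Subtype.val) ↑(m.image Subtype.val) (ε n ^^ Nat.bodd m.card)) ∧
            (∀ (m : Finset {ℓ // Zhang2014.IsKolyvaginPrime (W.conductorNorm ℤ) W K 3 ℓ}) (ℓ : {ℓ // Zhang2014.IsKolyvaginPrime (W.conductorNorm ℤ) W K 3 ℓ}), ℓ ∈ m →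
              ∀ (v : HeightOneSpectrum (𝓞 K)), ((ℓ : ℕ) : 𝓞 K) ∈ v.asIdeal → ∀ 𝔓 ∈ v.primesAbove,
              κ m n ∈ subgroupResKer (geomTorsion (W.baseChange K) ((3 ^ 1 : ℕ) : ℤ))
                (𝔓.decompositionSubgroup (Field.absoluteGaloisGroup K) ⊓ ringClassStabilizer K ι (ℓ : ℕ) (ℓ : ℕ))) ∧
            (∀ (m : Finset {ℓ // Zhang2014.IsKolyvaginPrime (W.conductorNorm ℤ) W K 3 ℓ}) (ℓ : {ℓ // Zhang2014.IsKolyvaginPrime (W.conductorNorm ℤ) W K 3 ℓ}), ℓ ∉ m →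
              ∀ (v : HeightOneSpectrum (𝓞 K)), ((ℓ : ℕ) : 𝓞 K) ∈ v.asIdeal →
              (κ (insert ℓ m) n ∈ (W.baseChange K).torsionLocalKer (v.adicCompletion K) ((3 ^ 1 : ℕ) : ℤ) ↔
                κ m n ∈ (W.baseChange K).torsionLocalKer (v.adicCompletion K) ((3 ^ 1 : ℕ) : ℤ)))) ∧
          -- (A2) Thm 4.3 pointwise, vanishing form, from an EVEN good level n (incl. ∅) to n ∪ (q₁, q₂)
          (∀ (n : Finset {q // IsUAdmissiblePrime W K q}) (q₁ q₂ : {q // IsUAdmissiblePrime W K q}),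
            GoodLevel W K n → Even n.card → GoodLevel W K (insert q₂ (insert q₁ n)) → q₁ ∉ n → q₂ ∉ insert q₁ n →
            ∀ (m : Finset {ℓ // Zhang2014.IsKolyvaginPrime (W.conductorNorm ℤ) W K 3 ℓ}) (v₁ : HeightOneSpectrum (𝓞 K)), ((q₁ : ℕ) : 𝓞 K) ∈ v₁.asIdeal →
              ∀ (v₂ : HeightOneSpectrum (𝓞 K)), ((q₂ : ℕ) : 𝓞 K) ∈ v₂.asIdeal →
              (κ m n ∈ (W.baseChange K).torsionLocalKer (v₁.adicCompletion K) ((3 ^ 1 : ℕ) : ℤ) ↔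
                κ m (insert q₂ (insert q₁ n)) ∈
                  (W.baseChange K).torsionLocalKer (v₂.adicCompletion K) ((3 ^ 1 : ℕ) : ℤ))) ∧
          -- (A5⁺) Thm 7.2 at every good even NON-EMPTY level of canonical rank one
          (∀ n : Finset {q // IsUAdmissiblePrime W K q}, GoodLevel W K n → n.Nonempty → Even n.card →
            finrank (ZMod 3) (SelQ W K c n true) + finrank (ZMod 3) (SelQ W K c n false) = 1 → κ ∅ n ≠ 0)) :
    Summit.BirchSwinnertonDyer.BirchSwinnertonDyer.Theses.KolyvaginRoadThree.ZhangSharpFrameAtThreeHL := by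
  intro W _ _ _ K _ _ Dt β ι hX hmult hsurj hram htam hK hodd hH hLt h3 hβ hc
  obtain ⟨c, hc1, hcc⟩ := exists_algEquiv_ne_one_mul_self_eq_one K hK
  -- the unique `ZMod 3`-module structure on `H¹(K, E[3])`
  letI : Module (ZMod 3) (V3 W K) :=
    AddCommGroup.zmodModule (fun x ↦ by
      have h := zsmul_discreteH1_torsion ((3 ^ 1 : ℕ) : ℤ) x
      rw [natCast_zsmul] at h
      simpa using h)
  have hPar := stub_oddSelmerRankAtThree W K Dt β ι hX hmult hsurj hram htam hK hodd hH hLt h3 hβ hc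
  by_cases h1 : finrank (ZMod 3)
        (AddSubgroup.toZModSubmodule 3 (selmerGroup (W.baseChange K) ((3 ^ 1 : ℕ) : ℤ))) = 1
  · -- Selmer rank one: the bottom base case, witness `n = 1`
    obtain ⟨d, hd⟩ := stub_bottomRankOneAtThree W K Dt β ι hX hmult hsurj hram htam hK hodd hH hLt h3 hβ hc h1
    exact ⟨1, d, KolyvaginDescent.kolSupp_one _, hd⟩
  · -- Selmer rank odd and `≠ 1`, hence `≥ 3`: Zhang's induction on the level-raised tower
    have hA1 := stub_levelRaisingAtThree W K Dt β ι hX hmult hsurj hram htam hK hodd hH hLt h3 hβ hc c hc1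
    have hT := stub_triangulationAtThree W K Dt β ι hX hmult hsurj hram htam hK hodd hH hLt h3 hβ hc c hc1
    obtain ⟨κ, ε, hbot, -, hKS, hA2, hA5⟩ :=
      stub_zhangTowerAtThree W K Dt β ι hX hmult hsurj hram htam hK hodd hH hLt h3 hβ hc c hc1
    -- parity at the bottom in `SelQ ∅` currency
    have hPar' := hPar
    rw [finrank_selmer_eq_finrank_selQ_add W K hK c hcc] at hPar'
    have h1' : finrank (ZMod 3) (SelQ W K c ∅ true) + finrank (ZMod 3) (SelQ W K c ∅ false) ≠ 1 := by
      rw [← finrank_selmer_eq_finrank_selQ_add W K hK c hcc]; exact h1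
    -- (A2) contrapositive from the pointwise congruence
    have hA2' : ∀ (n : Finset {q // IsUAdmissiblePrime W K q}) (q₁ q₂ : {q // IsUAdmissiblePrime W K q}),
        GoodLevel W K n → Even n.card → GoodLevel W K (insert q₁ n) → GoodLevel W K (insert q₂ (insert q₁ n)) →
        q₁ ∉ n → q₂ ∉ insert q₁ n → q₂ ∉ baseLocusQ W K κ (insert q₂ (insert q₁ n)) → ∃ m, κ m n ≠ 0 := by
      intro n q₁ q₂ hg hev _ hg₂ hq₁ hq₂ hB
      simp only [baseLocusQ, Set.mem_setOf_eq, not_forall] at hB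
      obtain ⟨m, v₂, hv₂, hm⟩ := hB
      -- the place (q₁) of K above the inert prime q₁
      let v₁ : HeightOneSpectrum (𝓞 K) := ⟨Ideal.span {((q₁ : ℕ) : 𝓞 K)}, q₁.2.2.2.2.2.1, by
        rw [Ne, Ideal.span_singleton_eq_bot]
        exact_mod_cast q₁.2.1.ne_zero⟩
      have hv₁ : ((q₁ : ℕ) : 𝓞 K) ∈ v₁.asIdeal := Ideal.mem_span_singleton_self _
      refine ⟨m, fun h0 ↦ hm ?_⟩
      refine (hA2 n q₁ q₂ hg hev hg₂ hq₁ hq₂ m v₁ hv₁ v₂ hv₂).mp ?_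
      rw [h0]
      exact AddSubgroup.zero_mem _
    -- (A3) at non-empty good even levels = stub T on the tower's Kolyvagin-system axioms
    have hA3' : ∀ (n : Finset {q // IsUAdmissiblePrime W K q}), GoodLevel W K n → n.Nonempty → Even n.card →
        (∃ m, κ m n ≠ 0) →
        ∃ (s : Bool) (d : ℕ), finrank (ZMod 3) (SelQ W K c n s) = d + 1 ∧
          SelQ W K c n s = SelRelQ W K c n (baseLocusQ W K κ n) s ∧
          FiniteDimensional (ZMod 3) (SelRelQ W K c n (baseLocusQ W K κ n) (!s)) ∧
          finrank (ZMod 3) (SelRelQ W K c n (baseLocusQ W K κ n) (!s)) ≤ d :=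
      fun n hg hne hev htrig ↦ hT n hg hne hev κ (ε n) (hKS n hg hne hev).1 (hKS n hg hne hev).2.1
        (hKS n hg hne hev).2.2 htrig
    -- (A4) relaxation is definitional
    have hA4' : ∀ (n : Finset {q // IsUAdmissiblePrime W K q}) (q : {q // IsUAdmissiblePrime W K q})
        (S : Set {q // IsUAdmissiblePrime W K q}) (s : Bool), GoodLevel W K n → GoodLevel W K (insert q n) →
        q ∉ n → q ∈ S → SelQ W K c n s ≤ SelRelQ W K c (insert q n) S s :=
      fun n q S s _ _ hqn hqS ↦ relaxation_le W K c n q S s hqn hqS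
    -- (A5): vacuous at the bottom (rank ≥ 3), the tower's (A5⁺) above it
    have hA5' : ∀ (n : Finset {q // IsUAdmissiblePrime W K q}), GoodLevel W K n → Even n.card →
        finrank (ZMod 3) (SelQ W K c n true) + finrank (ZMod 3) (SelQ W K c n false) = 1 → κ ∅ n ≠ 0 := by
      intro n hg hev hr
      by_cases hn : n = ∅
      · subst hn
        exact absurd hr h1'
      · exact hA5 n hg (Finset.nonempty_iff_ne_empty.mpr hn) hev hr
    obtain ⟨m, hm⟩ :=
      Summit.BirchSwinnertonDyer.Rank1Residual.X11b.Three.Koly.ZhangInductionOnPosOddStart.exists_ne_zero_at_bottom_of_zhangInduction_on_pos_oddStart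
        (GoodLevel W K) (goodLevel_empty W K) (SelQ W K c) (SelRelQ W K c) (baseLocusQ W K κ) κ ∅ hA1 hA2' hA3'
        hA4' hA5' hPar'
    obtain ⟨d, hd⟩ := hbot m
    exact ⟨∏ ℓ ∈ m, (ℓ : ℕ), d, kolSupp_prod m (fun ℓ _ ↦ ℓ.2.1), fun h0 ↦ hm (by rw [hd, h0])⟩

end Summit.BirchSwinnertonDyer.Rank1Residual.X11b.Three.Koly.Method2TowerCut

end
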